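import Mathlib
import Summits.ValiantsHypothesis.ValiantsHypothesis.Theses.PrincipalMinorColouring

/-!
# `PrincipalMinorColouring.Assembly` (stmt-ValiantsHypothesis-3787) — assembly of route PrincipalMinorColouring

The route's assembly item `Assembly`:
`TotalRankNotQP → TotalRankLeDc → QpArith → DcqpToVH → ValiantsHypothesis`.
This is pure logic (it is literally the type of the route's sorry-free deciding theorem
`Summit.ValiantsHypothesis.ValiantsHypothesis.Theses.PrincipalMinorColouring.closes`); the proof is
given here in full, independently of `closes`:
if `dc(per_n)` were quasi-polynomially bounded with constant `c`, `QpArith` gives a `c'` with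
`n² · 2^((log₂ n + c)^c) ≤ 2^((log₂ n + c')^c')`, `TotalRankNotQP` gives an `n` admitting no
principal-minor representation of `per_n(x+J)` of any size `R ≤ 2^((log₂ n + c')^c')`, while
`TotalRankLeDc` gives one of size `R ≤ n² · dc(per_n) ≤ n² · 2^((log₂ n + c)^c) ≤ 2^((log₂ n + c')^c')`
— contradiction; so `dc(per_n)` is not qp-bounded and `DcqpToVH` yields `ValiantsHypothesis`.
Bürgisser 2000 §2; BCS97 (21.40). [folklore]
-/

namespace Summit.ValiantsHypothesis.ValiantsHypothesis.Theorems.PrincipalMinorColouring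

-- `Summit.ValiantsHypothesis.ValiantsHypothesis.…` is the tree's mandated single-conjunct layout (Sub = Summit).
set_option linter.dupNamespace false

/-- **`Assembly` holds** (item stmt-ValiantsHypothesis-3787, assembly of route PrincipalMinorColouring):
`TotalRankNotQP → TotalRankLeDc → QpArith → DcqpToVH → ValiantsHypothesis`.
Pure logic: assuming `dc(per_n)` qp-bounded with constant `c`, take `c'` from `QpArith`, `n` from
`TotalRankNotQP c'`, and the representation of size `R ≤ n² · dc(per_n)` from `TotalRankLeDc n`;
then `R ≤ n² · 2^((log₂ n + c)^c) ≤ 2^((log₂ n + c')^c')` contradicts `TotalRankNotQP`, so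
`dc(per_n)` is not qp-bounded and `DcqpToVH` concludes. [folklore] -/
theorem assembly_proof :
    Summit.ValiantsHypothesis.ValiantsHypothesis.Theses.PrincipalMinorColouring.Assembly := by
  unfold Summit.ValiantsHypothesis.ValiantsHypothesis.Theses.PrincipalMinorColouring.Assembly
  intro h_TotalRankNotQP h_TotalRankLeDc h_QpArith h_DcqpToVH
  refine h_DcqpToVH ?_
  rintro ⟨c, hc⟩
  obtain ⟨c', hc'⟩ := h_QpArith c
  obtain ⟨n, hn⟩ := h_TotalRankNotQP c'
  obtain ⟨R, hR, K, κ, hrepr⟩ := h_TotalRankLeDc n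
  exact hn R (hR.trans ((Nat.mul_le_mul_left (n ^ 2) (hc n)).trans (hc' n))) ⟨K, κ, hrepr⟩

end Summit.ValiantsHypothesis.ValiantsHypothesis.Theorems.PrincipalMinorColouring
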